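import Summits.Ventures.Crystal3D.Theorems.StickyWulffConstantTextureLiminfTexShadowSemanticCutGlue
import Summits.Ventures.Crystal3D.Theorems.StickyWulffConstantTextureLiminfTexShadowCoverageBarlowSteerWideGlue
import HarnessLib

/-!
# TexShadow row (e): the SEMANTIC CUT over the WIDE-STEERED menu (v8.6 registration shape, cf-p1 DECISION (cxxx))
# (lane T, crux `TextureLiminfV5`, stmt-Ventures-23912; sub-crux EDGE-ON `stub_edgeOn`)

HONEST FRAMING. Venture `Summits/Ventures/Crystal3D` (cell `crystal3d-full`), route `route-Ventures-StickyWulffConstant`, helper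
`--supports` the law-v5 crux `TextureLiminfV5` (stmt-Ventures-23912), line `TexShadow` v8.5 → v8.6.  PURE BOOKKEEPING (census-free, standard axioms):
every wall input is a HYPOTHESIS; no certificate, no cell is proved; rung F-C1 not moved.

THE POINT.  wulff-p2's `residualFaultedCoreAt_of_certCut` (…TexShadowSemanticCutGlue, p696994) dispatches the faulted residual core along ANY orientation
predicate `Cert` closed by a K1a-type ledger, leaving «¬EdgeOn ∧ ¬Cert» (read holes) and K4.  With the wide-steered menu in the tree
(`BarlowMenuSteerWideCertified`, closer `faultedOnAt_of_steerWideCoverageBarlowOn`, p700748/p702313) the certified predicate of record becomes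
`Cert := BarlowMenuSteerWideCertified c₀` (canonical ∨ chosen ∨ steered 1/4 ∨ steered 1/3):
* `steerWideCoverageBarlowOn_certified` — the identity certificate on the regime «wide-steer-menu certified»;
* `residualFaultedCoreAt_of_semanticCutSteerWide(')` and **`stub_residualFaultedCore_of_semanticCutSteerWide : P5Exhaustion → StarPairFar →
  (∃ C, BilayerWallResidualFaultedCoreOnAt (¬EdgeOnAt (13/25) ∧ ¬BarlowMenuSteerWideCertified (13/25)) (13/25) C 10) →
  (∃ C, BilayerWallResidualFaultedEdgeOnAt (13/25) C 10) → ∃ C, BilayerWallResidualFaultedCoreAt (13/25) C 10`** — v8.6's `stub_residualFaultedCore`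
  derived from `stub_readHolesS` and the frozen `stub_edgeOn`;
* `residualFaultedCoreOnAt_steerWideHoles_of_semanticHoles` — the steered read holes are a SUB-region of the canonical read holes (monotonicity for v8.4 → v8.6).
WHAT THIS IS NOT: no certificate; the engine's measured region is NOT an obligation here; F-C1 not moved.
-/

noncomputable section

namespace Summit.Ventures.Crystal3D.Cruxes.TextureLiminf.TexShadow

open Summit.Ventures.Crystal3D Summit.Ventures.Crystal3D.Theorems Finset
open Literature.MathematicalPhysics.StatisticalMechanics (IsHaggSeq fccStacking barlowStacking basalMirror)
open scoped InnerProductSpace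

/-- **The identity certificate, wide-steered menu**: on the regime «wide-steer-menu certified» every pair is certified. -/
theorem steerWideCoverageBarlowOn_certified (c₀ : ℝ) : ResidualSteerWideCoverageBarlowOn (BarlowMenuSteerWideCertified c₀) c₀ :=
  fun _ _ _ _ _ _ _ h => h

/-- **THE SEMANTIC CUT OVER THE WIDE-STEERED MENU, `ExactOnly` form** (`R₀ ≥ 6`). -/
theorem residualFaultedCoreAt_of_semanticCutSteerWide {sE : E3} (hsE : sE ∈ fccSlots)
    (hcert : ExactOnly 0 (fccSlots.filter fun w => 0 < ⟪w, sE⟫_ℝ))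
    (hDS : ∀ F₁ F₂ : E3 ≃ₗᵢ[ℝ] E3, DoubleStarCoaxialAt F₁ F₂) (hCP : CapPairCoaxial) {c₀ R₀ : ℝ} (hR₀ : 6 ≤ R₀)
    (hholes : ∃ C : ℝ, BilayerWallResidualFaultedCoreOnAt
      (fun σ₁ σ₂ L₁ L₂ => ¬ EdgeOnAt c₀ σ₁ σ₂ L₁ L₂ ∧ ¬ BarlowMenuSteerWideCertified c₀ σ₁ σ₂ L₁ L₂) c₀ C R₀)
    (hK4 : ∃ C : ℝ, BilayerWallResidualFaultedEdgeOnAt c₀ C R₀) :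
    ∃ C : ℝ, BilayerWallResidualFaultedCoreAt c₀ C R₀ :=
  residualFaultedCoreAt_of_certCut (by linarith)
    (faultedOnAt_of_steerWideCoverageBarlowOn hsE hcert hDS hCP (steerWideCoverageBarlowOn_certified c₀) hR₀) hholes hK4

/-- **THE SEMANTIC CUT OVER THE WIDE-STEERED MENU, named-fact form** (`R₀ ≥ 6`). -/
theorem residualFaultedCoreAt_of_semanticCutSteerWide' (hE1 : P5Exhaustion) (hSP : StarPairFar) {c₀ R₀ : ℝ} (hR₀ : 6 ≤ R₀)
    (hholes : ∃ C : ℝ, BilayerWallResidualFaultedCoreOnAt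
      (fun σ₁ σ₂ L₁ L₂ => ¬ EdgeOnAt c₀ σ₁ σ₂ L₁ L₂ ∧ ¬ BarlowMenuSteerWideCertified c₀ σ₁ σ₂ L₁ L₂) c₀ C R₀)
    (hK4 : ∃ C : ℝ, BilayerWallResidualFaultedEdgeOnAt c₀ C R₀) :
    ∃ C : ℝ, BilayerWallResidualFaultedCoreAt c₀ C R₀ := by
  obtain ⟨sE, hsE, hcert⟩ := exactOnly_star_of_p5Exhaustion hE1
  exact residualFaultedCoreAt_of_semanticCutSteerWide hsE hcert (doubleStarCoaxialAt_of_starPairFar hSP)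
    (capPairCoaxial_of_starPairFar hSP) hR₀ hholes hK4

/-- **`stub_residualFaultedCore` BY NAME from the wide-steered semantic cut at `(13/25, 10)`** (v8.6): {E1, StarPairFar,
`stub_readHolesS : ∃ C, BilayerWallResidualFaultedCoreOnAt (¬EdgeOnAt (13/25) ∧ ¬BarlowMenuSteerWideCertified (13/25)) (13/25) C 10`, the frozen `stub_edgeOn`}. -/
theorem stub_residualFaultedCore_of_semanticCutSteerWide (hE1 : P5Exhaustion) (hSP : StarPairFar)
    (hholes : ∃ C : ℝ, BilayerWallResidualFaultedCoreOnAt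
      (fun σ₁ σ₂ L₁ L₂ => ¬ EdgeOnAt (13 / 25) σ₁ σ₂ L₁ L₂ ∧ ¬ BarlowMenuSteerWideCertified (13 / 25) σ₁ σ₂ L₁ L₂) (13 / 25) C 10)
    (hK4 : ∃ C : ℝ, BilayerWallResidualFaultedEdgeOnAt (13 / 25) C 10) :
    ∃ C : ℝ, BilayerWallResidualFaultedCoreAt (13 / 25) C 10 :=
  residualFaultedCoreAt_of_semanticCutSteerWide' hE1 hSP (by norm_num) hholes hK4

/-- **Monotonicity of the read holes (v8.4 → v8.6)**: the canonical read-hole core gives the wide-steered read-hole core (a certified-canonical pair is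
wide-steer-menu certified, so the steered holes are contained in the canonical holes). -/
theorem residualFaultedCoreOnAt_steerWideHoles_of_semanticHoles {c₀ C R₀ : ℝ}
    (h : BilayerWallResidualFaultedCoreOnAt
      (fun σ₁ σ₂ L₁ L₂ => ¬ EdgeOnAt c₀ σ₁ σ₂ L₁ L₂ ∧ ¬ BarlowOneSidedCertified c₀ σ₁ σ₂ L₁ L₂) c₀ C R₀) :
    BilayerWallResidualFaultedCoreOnAt
      (fun σ₁ σ₂ L₁ L₂ => ¬ EdgeOnAt c₀ σ₁ σ₂ L₁ L₂ ∧ ¬ BarlowMenuSteerWideCertified c₀ σ₁ σ₂ L₁ L₂) c₀ C R₀ :=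
  fun σ₁ σ₂ hσ₁ hσ₂ hf L₁ L₂ s₁ s₂ A₁ A₂ u₁ u₂ hA₁ hA₂ hres hrem c m hadm hleaf =>
    h σ₁ σ₂ hσ₁ hσ₂ hf L₁ L₂ s₁ s₂ A₁ A₂ u₁ u₂ hA₁ hA₂ hres
      ⟨hrem.1, fun hcan => hrem.2 (Or.inl (Or.inl (Or.inl hcan)))⟩ c m hadm hleaf

end Summit.Ventures.Crystal3D.Cruxes.TextureLiminf.TexShadow

end
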